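import Summits.RiemannHypothesis.RiemannHypothesis.Theses.RuelleBand
import Literature.Barriers.RiemannHypothesis.BohrDenseValuesProofs
import Literature.NumberTheory.LFunctions.GeneralizedRH
import HarnessLib

/-!
# Line `nrib-weak-recurrence` — crux `ExactFirstBand` (stmt-RiemannHypothesis-2061, route RuelleBand)

Crux-strategist skeleton (seat cstrat-stmt-RiemannHypothesis-2061-r1; BC2 REDIRECT of the deciding crux).
`X := ExactFirstBand` is kernel-checked `↔ RiemannHypothesis` (`Negative.exactFirstBand_iff_riemannHypothesis`),
so EVERY admissible stub set of EVERY line composes to RH (meta-fact, Lines/Sketch-dead.md §0); the two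
built lines (`Sketch`, `SketchIdeator1`) died with ONE open stub each, that stub kernel-checked `↔ RH`.
This line is the only shape that avoids that death: TWO open stubs, each RH-implied, NEITHER known to be
RH-equivalent (cheap probes `stub → X`, `stub → RH` fail: folder bc/probes.lean, 8/8 unsolved), glued by a
THEOREM (Rouché), not by a tautology:

* `stub_noRightInteriorBand` (NRIB) — the real parts of the zeros of `ζ` do not accumulate at any
  interior abscissa `σ₀ ∈ (1/2, 1)` (window form). Verbatim stub 1 of crux #4's registered line
  `interior-edge-split` (drefute: SURVIVED — not false, not misstated, not trivial; RH-implied open;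
  `ACL ↔ NRIB ∧ StripZeroFreeStrip` and `NRIB ↔ windowed BandRealisation` LANDED:
  `RuelleBandAsymptoticCriticalLineSplit`, `RuelleBandAsymptoticCriticalLineWindowedBandRealisation`,
  `noRightInteriorBand_of_windowedRealisation`). It is the OUTPUT TYPE of the route's windowed
  three-circle construction (`RuelleBand.finite_jointEigenvalues_annulus`), i.e. what band theory
  delivers WITHOUT exactness and WITHOUT the edge.
* `stub_zetaWeakRecurrence` (WR) — weak (Poincaré) recurrence of `ζ` under vertical shifts on every
  closed disc of the half-strip `1/2 < Re s < 1`: for every `ε` and every height `T` some `τ ≥ T` with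
  `max_disc |ζ(s+iτ) − ζ(s)| < ε`. RH-implied (Bagchi, from the tree's PROVED Voronin theorem);
  UNCONDITIONAL on zero-free discs (Voronin, `Steuding2007_thm1_9_discAnalytic_holds`); open exactly on
  discs about hypothetical off-line zeros. A statement about VALUES, replacing the route's two
  mechanism-free glue rungs `AsymptoticToCofinite`/`CofiniteToExact` ("exceptional resonances are real").

Composition `ExactFirstBand_of : NRIB → WR → ExactFirstBand` (about 90 lines, no sorry): an off-line zero
`ξ` (w.l.o.g. `Re ξ > 1/2`) is isolated; NRIB bounds the height of the zeros in a window about `Re ξ`;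
with `ε = min |ζ|` on a small circle about `ξ`, a late return `τ` (WR) GENERATES by Rouché
(`exists_zero_near_shift`, Steuding Thm 8.3 eq. (8.5)) a zero within `δ` of `ξ + iτ` — inside the window,
above the bound. The same proof lands as `Theorems/RuelleBandExactFirstBandSplit.lean` (attached as item
evidence; Theorems/ is prover-only for this seat).

Disproof used: `exactFirstBand_iff_riemannHypothesis` (§1: the stub conjunction is RH — by design, split
into two not-known-equivalent halves); load-bearing analysis §2 (only `ζ s = 0` carries weight: both stubs
speak about `riemannZeta` itself — NRIB fails for `ζ₃ = 1+2^{-s}+3^{-s}`, Epstein, Davenport–Heilbronn,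
WR's Rouché step needs the zero to be a zero of the SAME function that recurs); no `-- Targets` stub of
Disproof.lean is an instance of either stub. NOT registered with `ledger skeleton check` by this seat
(the live lead c3 holds the item's single skeleton record `Sketch`; registering would replace its stub
list) — register at a cycle boundary.
-/

set_option linter.dupNamespace false

noncomputable section

open Complex Set Metric Filter Topology

namespace Summit.RiemannHypothesis.RiemannHypothesis.Cruxes.ExactFirstBand.NribWeakRecurrence

open Summit.RiemannHypothesis.RiemannHypothesis.Theses.RuelleBand
open Literature.Barriers.RiemannHypothesis
open Literature.NumberTheory.LFunctions

/-! ## The registered stubs (`sorry` lives only here) -/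

/-- **STUB 1 · `stub_noRightInteriorBand`** — NO RIGHT-INTERIOR BAND: every `σ₀ ∈ (1/2, 1)` has a vertical
neighbourhood `|Re s − σ₀| < ε` containing only finitely many zeros of `ζ`. RH-implied, OPEN (size XL: at one
`σ₀` it is already an eventual zero-free vertical neighbourhood; it implies Lindelöf via Backlund's window
counts). Supplier in the route's language: a PINNED windowed three-circle construction over
`Meyer.ideleClassSchwartzWeighted ℚ (a, 1−a)` (`noRightInteriorBand_of_windowedRealisation`, landed). -/
theorem stub_noRightInteriorBand :
    ∀ σ₀ : ℝ, 1 / 2 < σ₀ → σ₀ < 1 →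
      ∃ ε : ℝ, 0 < ε ∧ {s : ℂ | riemannZeta s = 0 ∧ 0 < s.re ∧ s.re < 1 ∧ |s.re - σ₀| < ε}.Finite := by
  sorry

/-- **STUB 2 · `stub_zetaWeakRecurrence`** — WEAK SHIFT-RECURRENCE of `ζ` on every closed disc
`|s − z| ≤ r`, `0 < r < min (Re z − 1/2, 1 − Re z)`: `∀ ε > 0, ∀ T, ∃ τ ≥ T, max_disc |ζ(s+iτ) − ζ(s)| < ε`.
RH-implied (Bagchi/Voronin, tree); unconditional on zero-free discs; open on discs about off-line zeros,
where the returning shifts form a set of lower density ZERO (Bagchi's counting step) — the regime every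
Bohr–Jessen limit theorem is blind to (size XL; no supplier in print). -/
theorem stub_zetaWeakRecurrence :
    ∀ (z : ℂ) (r : ℝ), 0 < r → r < min (z.re - 1 / 2) (1 - z.re) →
      ∀ ε : ℝ, 0 < ε → ∀ T : ℝ, ∃ τ : ℝ, T ≤ τ ∧
        ∀ s ∈ closedBall z r, ‖riemannZeta (s + τ * I) - riemannZeta s‖ < ε := by
  sorry

/-! ## The composition (kernel-checked; no sorry below this line) -/

/-- **COMPOSITION** `NRIB → WR → ExactFirstBand` (Rouché + "no interior accumulation"; Bagchi's argument
with the density theorem replaced by NRIB and positive density of returns by unboundedly many returns).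
[cite: Steuding2007, Thm. 8.3 (proof)] [cite: Bagchi1987, main theorem] -/
theorem ExactFirstBand_of
    (hN : ∀ σ₀ : ℝ, 1 / 2 < σ₀ → σ₀ < 1 →
      ∃ ε : ℝ, 0 < ε ∧ {s : ℂ | riemannZeta s = 0 ∧ 0 < s.re ∧ s.re < 1 ∧ |s.re - σ₀| < ε}.Finite)
    (hW : ∀ (z : ℂ) (r : ℝ), 0 < r → r < min (z.re - 1 / 2) (1 - z.re) →
      ∀ ε : ℝ, 0 < ε → ∀ T : ℝ, ∃ τ : ℝ, T ≤ τ ∧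
        ∀ s ∈ closedBall z r, ‖riemannZeta (s + τ * I) - riemannZeta s‖ < ε) :
    ExactFirstBand := by
  intro s hs h0 h1
  by_contra hnot
  push Not at hnot
  obtain ⟨hne, -⟩ := hnot
  -- Step 0: an off-line zero `ξ` in the right half of the open strip
  obtain ⟨ξ, hξ0, hξhalf, hξ1⟩ : ∃ ξ : ℂ, riemannZeta ξ = 0 ∧ 1 / 2 < ξ.re ∧ ξ.re < 1 := by
    rcases lt_or_gt_of_ne hne with hlt | hgt
    · refine ⟨1 - s, GeneralizedRH.riemannZeta_one_sub_eq_zero hs h0 h1, ?_, ?_⟩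
      · simp only [sub_re, one_re]; linarith
      · simp only [sub_re, one_re]; linarith
    · exact ⟨s, hs, hgt, h1⟩
  -- Step 1: NRIB at `σ₀ = Re ξ`: a window of radius `ε₁` whose zeros have height `≤ M`
  obtain ⟨ε₁, hε₁, hfin⟩ := hN ξ.re hξhalf hξ1
  obtain ⟨M, hM⟩ := (hfin.image Complex.im).bddAbove
  -- Step 2: `ξ` is an isolated zero
  have hξne1 : ξ ≠ 1 := by
    intro h; rw [h, one_re] at hξ1; exact lt_irrefl _ hξ1
  have han : AnalyticAt ℂ riemannZeta ξ := analyticOn_riemannZeta ξ hξne1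
  have hev : ∀ᶠ w in 𝓝[≠] ξ, riemannZeta w ≠ 0 := by
    rcases han.eventually_eq_zero_or_eventually_ne_zero with h0' | hne'
    · exfalso
      have h2 : riemannZeta 2 = 0 :=
        analyticOn_riemannZeta.eqOn_zero_of_preconnected_of_eventuallyEq_zero
          (isConnected_compl_singleton_of_one_lt_rank (by simp) (1 : ℂ)).isPreconnected hξne1 h0'
          (show (2 : ℂ) ∈ ({1}ᶜ : Set ℂ) by norm_num)
      exact riemannZeta_ne_zero_of_one_le_re (s := 2) (by norm_num) h2
    · exact hne'
  obtain ⟨δ₁, hδ₁, hpunct⟩ : ∃ δ₁ > 0, ∀ w : ℂ, dist w ξ < δ₁ → w ≠ ξ → riemannZeta w ≠ 0 := by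
    rw [eventually_nhdsWithin_iff, Metric.eventually_nhds_iff] at hev
    obtain ⟨δ₁, hδ₁, h⟩ := hev
    exact ⟨δ₁, hδ₁, fun w hw hne ↦ h hw hne⟩
  -- Step 3: a radius `δ` inside the punctured disc, inside the strip, and inside the NRIB window
  set m : ℝ := min (ξ.re - 1 / 2) (1 - ξ.re) with hmdef
  have hmpos : 0 < m := lt_min (by linarith) (by linarith)
  set δ : ℝ := min (min (δ₁ / 2) (m / 2)) (ε₁ / 2) with hδdef
  have hδpos : 0 < δ := lt_min (lt_min (by linarith) (by linarith)) (by linarith)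
  have hδ₁' : δ < δ₁ := ((min_le_left _ _).trans (min_le_left _ _)).trans_lt (by linarith)
  have hδm : δ < m := ((min_le_left _ _).trans (min_le_right _ _)).trans_lt (by linarith)
  have hδε₁ : δ < ε₁ := (min_le_right _ _).trans_lt (by linarith)
  have hδhalf : δ < ξ.re - 1 / 2 := hδm.trans_le (min_le_left _ _)
  have hδone : δ < 1 - ξ.re := hδm.trans_le (min_le_right _ _)
  -- Step 4: `ε := min_{|w−ξ|=δ} |ζ(w)| > 0`
  have hcont : ContinuousOn (fun w ↦ ‖riemannZeta w‖) (sphere ξ δ) := by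
    refine ContinuousOn.norm fun w hw ↦ ?_
    have hw1 : w ≠ 1 := by
      intro h
      rw [h, mem_sphere, dist_eq_norm] at hw
      have := abs_re_le_norm (1 - ξ)
      rw [hw, sub_re, one_re] at this
      rw [abs_le] at this
      linarith [this.1]
    exact (differentiableAt_riemannZeta hw1).continuousAt.continuousWithinAt
  obtain ⟨w₀, hw₀, hmin⟩ := (isCompact_sphere ξ δ).exists_isMinOn
    (NormedSpace.sphere_nonempty.2 hδpos.le) hcont
  set ε : ℝ := ‖riemannZeta w₀‖ with hεdef
  have hεpos : 0 < ε := by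
    rw [hεdef, norm_pos_iff]
    refine hpunct w₀ ?_ ?_
    · rw [mem_sphere.1 hw₀]; exact hδ₁'
    · intro h
      have := mem_sphere.1 hw₀
      rw [h, dist_self] at this
      exact hδpos.ne this
  have hεle : ∀ w ∈ sphere ξ δ, ε ≤ ‖riemannZeta w‖ := fun w hw ↦ hmin hw
  -- Step 5: a LATE return (weak recurrence) and the zero it generates (Rouché)
  obtain ⟨τ, hτT, hτ⟩ := hW ξ δ hδpos hδm ε hεpos (M + δ + 1 - ξ.im)
  obtain ⟨ρ, hρ0, hρdist⟩ := exists_zero_near_shift hξ0 hδpos (by linarith) hεle hτ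
  -- Step 6: `ρ` lies in the NRIB window about `Re ξ` and has height `> M`: contradiction
  rw [dist_eq_norm] at hρdist
  have hre : |ρ.re - ξ.re| < δ := by
    have h := abs_re_le_norm (ρ - (ξ + τ * I))
    have h' : (ρ - (ξ + τ * I)).re = ρ.re - ξ.re := by
      simp only [sub_re, add_re, mul_re, ofReal_re, ofReal_im, I_re, I_im]; ring
    rw [h'] at h
    exact h.trans_lt hρdist
  have him : |ρ.im - (ξ.im + τ)| < δ := by
    have h := abs_im_le_norm (ρ - (ξ + τ * I))
    have h' : (ρ - (ξ + τ * I)).im = ρ.im - (ξ.im + τ) := by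
      simp only [sub_im, add_im, mul_im, ofReal_re, ofReal_im, I_re, I_im]; ring
    rw [h'] at h
    exact h.trans_lt hρdist
  have hre' := hre
  rw [abs_lt] at hre' him
  have hρmem : ρ ∈ {s : ℂ | riemannZeta s = 0 ∧ 0 < s.re ∧ s.re < 1 ∧ |s.re - ξ.re| < ε₁} :=
    ⟨hρ0, by linarith, by linarith, hre.trans hδε₁⟩
  have hle : ρ.im ≤ M := hM (Set.mem_image_of_mem Complex.im hρmem)
  linarith

/-- The line concludes the crux BY NAME. -/
theorem exactFirstBand : ExactFirstBand :=
  ExactFirstBand_of stub_noRightInteriorBand stub_zetaWeakRecurrence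

end Summit.RiemannHypothesis.RiemannHypothesis.Cruxes.ExactFirstBand.NribWeakRecurrence

end
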